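import Summits.ABC.ABC.Theses.DefiniteXi
import Summits.ABC.ABC.Theorems.DefiniteXiXiStrongBoundAllTamExp
import Summits.ABC.ABC.Theorems.DefiniteXiSteinbergCoreXi10Assembly
import HarnessLib

/-!
# Line `p6-tamagawa-split` — PLAN R″ reshape (k1 gen 45 draft, NOT registered) — crux `SteinbergCore` (stmt-ABC-15024)

Farm-independent, TREE-IMPORTS-ONLY reshape of the registered skeleton `Lines/p6_tamagawa_split.lean` (sha cda023e8):
* child 1 `stub_xiDegreeComparison` is no longer a stub: it is the landed theorem
  `Summit.ABC.ABC.Theorems.SteinbergCoreXi.StubIdeasK1G11.stub_xiDegreeComparison_of_oneSided` (helper module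
  `Theorems/DefiniteXiSteinbergCoreXi10Assembly.lean`, p845341) applied to TWO NEW STUBS — `stub_oneSidedFrey` (the one-sided
  Frey valuation inequality `v_p r_{D.f} ≤ v_p deg φ_D`, `p ≥ 5`; formal debt = Agashe–Ribet–Stein 2012 Thm 2.1(b); fact-conditional
  close available NOW: `StubIdeasK1G11.padicValNat_congruenceNumber_le_padicValNat_deg_of_frey hARS`, Xi8) and `stub_freyModularity`
  (verbatim the route item `DefiniteXi.FreyModularity`, stmt-ABC-11340; fact-conditional close `freyModularity_of_CDT_theorem_7_1_2'`);
* stubs 2 (`stub_primeToSixDegreeBound`, the abc atom P6) and 3 (`stub_abcValuationProduct`) verbatim;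
* the landed split glue `steinbergCore_of_subs_frey` (module `DefiniteXiSteinbergCoreSplit`, STILL `remote:stale … unbuilt` on the farm,
  rc 75 at 2026-09-01T16:15Z) is inlined as `glueFrey_inline` (k1 gen 37), so the file needs only built modules;
* `SteinbergCore_of` is 4-ary and concludes the crux BY NAME.  Expected audit: sorries = 4 = the stubs, 0 elsewhere.
A lead registers it with `ledger crux write stmt-ABC-15024 Lines/p6_tamagawa_split.lean --file <this>` (namespace renamed back to
`…P6TamagawaSplit`) + `ledger skeleton check $(ledger crux dir stmt-ABC-15024)/Lines/p6_tamagawa_split.lean --crux stmt-ABC-15024`.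
-/

set_option linter.dupNamespace false

namespace Summit.ABC.ABC.Cruxes.SteinbergCore.P6TamagawaSplitR45

open Literature.NumberTheory.EllipticCurves Literature.NumberTheory.Automorphic
open Literature.NumberTheory.EllipticCurves.ModularForms

noncomputable section

/-- **Stub 1a — one-sided Frey valuation inequality** `v_p r_{D.f} ≤ v_p deg φ_D` for every Frey datum and every prime
`p ≥ 5` (formal debt: Agashe–Ribet–Stein 2012 Thm 2.1(b) for the optimal quotient, `p² ∤ N` — true for odd `p` since
`N ∣ 2⁸ rad`; transported to arbitrary data by `exists_optimalDatum'` + `modularDegree_eq_card_ker_mul`).  Closes TODAY modulo the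
named fact: `:= fun a b hab h0 N _ hN D p hp h5 => StubIdeasK1G11.padicValNat_congruenceNumber_le_padicValNat_deg_of_frey hARS hab h0 hN D hp h5`.
ARS-free programme = k1 g17 N1′ (Gorenstein / multiplicity one; ≥ 6 cycles). [cite: AgasheRibetStein2012, Thm. 2.1] -/
theorem stub_oneSidedFrey :
    ∀ (a b : ℤ), IsCoprime a b → a * b * (a + b) ≠ 0 →
      ∀ (N : ℕ) [NeZero N], (Literature.NumberTheory.EllipticCurves.freyCurve a b).conductorNorm ℤ = N →
      ∀ (D : Literature.NumberTheory.EllipticCurves.ModularForms.ModularParametrizationData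
          (Literature.NumberTheory.EllipticCurves.freyCurve a b) N) (p : ℕ), p.Prime → 5 ≤ p →
        padicValNat p (Literature.NumberTheory.EllipticCurves.ModularForms.congruenceNumber D.f) ≤
          padicValNat p D.modularDegree := by
  sorry

/-- **Stub 1b — modularity of Frey curves** (verbatim the route item `DefiniteXi.FreyModularity`, stmt-ABC-11340: 4 stubs open on its
own line; facts-only close `Summit.ABC.ABC.Theorems.freyModularity_of_CDT_theorem_7_1_2' h712`). [cite: ConradDiamondTaylor1999, Thm. 7.1.2] -/
theorem stub_freyModularity :
    ∀ a b : ℤ, IsCoprime a b → a * b * (a + b) ≠ 0 → ∀ (N : ℕ) [NeZero N],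
      (Literature.NumberTheory.EllipticCurves.freyCurve a b).conductorNorm ℤ = N →
      Nonempty (Literature.NumberTheory.EllipticCurves.ModularForms.ModularParametrizationData
        (Literature.NumberTheory.EllipticCurves.freyCurve a b) N) := by
  sorry

/-- **Child 1 — `XiDegreeComparison`, now a THEOREM of the tree modulo stubs 1a/1b** (statement byte-identical to the registered
`stub_xiDegreeComparison`; proof = the landed helper Xi10, whose core `XiCongruenceComparison` is unconditional). -/
theorem child_xiDegreeComparison :
    ∀ ε : ℝ, 0 < ε → ∃ C : ℝ, ∀ a b : ℤ, IsCoprime a b → a * b * (a + b) ≠ 0 → ∀ (N : ℕ) [NeZero N],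
      (Literature.NumberTheory.EllipticCurves.freyCurve a b).conductorNorm ℤ = N →
      ∀ Nm : ℕ, Odd Nm → Squarefree Nm → Odd Nm.primeFactors.card → Nm ∣ N →
      Literature.NumberTheory.Automorphic.brandtXi (N / Nm) Nm
          (fun n => (Literature.NumberTheory.EllipticCurves.freyCurve a b).LFunction n) ≠ 0 →
      ∃ D : Literature.NumberTheory.EllipticCurves.ModularForms.ModularParametrizationData
        (Literature.NumberTheory.EllipticCurves.freyCurve a b) N,
        (∀ D' : Literature.NumberTheory.EllipticCurves.ModularForms.ModularParametrizationData
          (Literature.NumberTheory.EllipticCurves.freyCurve a b) N, D.deg ≤ D'.deg) ∧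
        ((Literature.NumberTheory.Automorphic.brandtXi (N / Nm) Nm
              (fun n => (Literature.NumberTheory.EllipticCurves.freyCurve a b).LFunction n) /
            (ordProj[2] (Literature.NumberTheory.Automorphic.brandtXi (N / Nm) Nm
                (fun n => (Literature.NumberTheory.EllipticCurves.freyCurve a b).LFunction n)) *
              ordProj[3] (Literature.NumberTheory.Automorphic.brandtXi (N / Nm) Nm
                (fun n => (Literature.NumberTheory.EllipticCurves.freyCurve a b).LFunction n))) : ℕ) : ℝ) ≤
          C * (N : ℝ) ^ ε * ((D.deg / (ordProj[2] D.deg * ordProj[3] D.deg) : ℕ) : ℝ) *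
            ((∏ q ∈ N.primeFactors, ((Literature.NumberTheory.EllipticCurves.freyCurve a b).minimalDiscriminantNorm
              ℤ).factorization q : ℕ) : ℝ) ^ 3 :=
  Summit.ABC.ABC.Theorems.SteinbergCoreXi.StubIdeasK1G11.stub_xiDegreeComparison_of_oneSided
    stub_oneSidedFrey stub_freyModularity

/-- **Stub 2 — Frey's degree conjecture away from 6 for minimal data** (abc-strength atom; child `PrimeToSixDegreeBound`). -/
theorem stub_primeToSixDegreeBound :
    ∀ ε : ℝ, 0 < ε → ∃ C : ℝ, ∀ a b : ℤ, IsCoprime a b → a * b * (a + b) ≠ 0 → ∀ (N : ℕ) [NeZero N],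
      (Literature.NumberTheory.EllipticCurves.freyCurve a b).conductorNorm ℤ = N →
      ∀ D : Literature.NumberTheory.EllipticCurves.ModularForms.ModularParametrizationData
        (Literature.NumberTheory.EllipticCurves.freyCurve a b) N,
        (∀ D' : Literature.NumberTheory.EllipticCurves.ModularForms.ModularParametrizationData
          (Literature.NumberTheory.EllipticCurves.freyCurve a b) N, D.deg ≤ D'.deg) →
        ((D.deg / (ordProj[2] D.deg * ordProj[3] D.deg) : ℕ) : ℝ) ≤ C * (N : ℝ) ^ (2 + ε) := by
  sorry

/-- **Stub 3 — the valuation-product milestone** (verbatim stmt-ABC-1567 `AbcValuationProduct`; shared with route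
RibetTakahashiSplit, closes there by `abcValuationProduct_of_many_few`). -/
theorem stub_abcValuationProduct :
    ∀ ε : ℝ, 0 < ε → ∃ K : ℝ, ∀ a b c : ℕ, Literature.NumberTheory.DiophantineGeometry.IsABCTriple a b c →
      ((∏ p ∈ (a * b * c).primeFactors, (a * b * c).factorization p : ℕ) : ℝ) ≤
        K * ((Literature.NumberTheory.DiophantineGeometry.rad a b c : ℕ) : ℝ) ^ ε := by
  sorry

/-- **Inlined landed glue** (verbatim the proof of `Summit.ABC.ABC.Theorems.steinbergCore_of_subs_frey`,
Theorems/DefiniteXiSteinbergCoreSplit.lean, p137293; copied here only because that module is unbuilt on the farm). -/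
theorem glueFrey_inline
    (hC : ∀ ε : ℝ, 0 < ε → ∃ C : ℝ, ∀ a b : ℤ, IsCoprime a b → a * b * (a + b) ≠ 0 → ∀ (N : ℕ) [NeZero N],
      (Literature.NumberTheory.EllipticCurves.freyCurve a b).conductorNorm ℤ = N →
      ∀ Nm : ℕ, Odd Nm → Squarefree Nm → Odd Nm.primeFactors.card → Nm ∣ N →
      Literature.NumberTheory.Automorphic.brandtXi (N / Nm) Nm
          (fun n => (Literature.NumberTheory.EllipticCurves.freyCurve a b).LFunction n) ≠ 0 →
      ∃ D : Literature.NumberTheory.EllipticCurves.ModularForms.ModularParametrizationData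
        (Literature.NumberTheory.EllipticCurves.freyCurve a b) N,
        (∀ D' : Literature.NumberTheory.EllipticCurves.ModularForms.ModularParametrizationData
          (Literature.NumberTheory.EllipticCurves.freyCurve a b) N, D.deg ≤ D'.deg) ∧
        ((Literature.NumberTheory.Automorphic.brandtXi (N / Nm) Nm
              (fun n => (Literature.NumberTheory.EllipticCurves.freyCurve a b).LFunction n) /
            (ordProj[2] (Literature.NumberTheory.Automorphic.brandtXi (N / Nm) Nm
                (fun n => (Literature.NumberTheory.EllipticCurves.freyCurve a b).LFunction n)) *
              ordProj[3] (Literature.NumberTheory.Automorphic.brandtXi (N / Nm) Nm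
                (fun n => (Literature.NumberTheory.EllipticCurves.freyCurve a b).LFunction n))) : ℕ) : ℝ) ≤
          C * (N : ℝ) ^ ε * ((D.deg / (ordProj[2] D.deg * ordProj[3] D.deg) : ℕ) : ℝ) *
            ((∏ q ∈ N.primeFactors, ((Literature.NumberTheory.EllipticCurves.freyCurve a b).minimalDiscriminantNorm
              ℤ).factorization q : ℕ) : ℝ) ^ 3)
    (hP : ∀ ε : ℝ, 0 < ε → ∃ C : ℝ, ∀ a b : ℤ, IsCoprime a b → a * b * (a + b) ≠ 0 → ∀ (N : ℕ) [NeZero N],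
      (Literature.NumberTheory.EllipticCurves.freyCurve a b).conductorNorm ℤ = N →
      ∀ D : Literature.NumberTheory.EllipticCurves.ModularForms.ModularParametrizationData
        (Literature.NumberTheory.EllipticCurves.freyCurve a b) N,
        (∀ D' : Literature.NumberTheory.EllipticCurves.ModularForms.ModularParametrizationData
          (Literature.NumberTheory.EllipticCurves.freyCurve a b) N, D.deg ≤ D'.deg) →
        ((D.deg / (ordProj[2] D.deg * ordProj[3] D.deg) : ℕ) : ℝ) ≤ C * (N : ℝ) ^ (2 + ε))
    (hT : ∀ ε : ℝ, 0 < ε → ∃ C : ℝ, ∀ a b : ℤ, IsCoprime a b → a * b * (a + b) ≠ 0 → ∀ (N : ℕ) [NeZero N],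
      (Literature.NumberTheory.EllipticCurves.freyCurve a b).conductorNorm ℤ = N →
      ((∏ q ∈ N.primeFactors, ((Literature.NumberTheory.EllipticCurves.freyCurve a b).minimalDiscriminantNorm
        ℤ).factorization q : ℕ) : ℝ) ≤ C * (N : ℝ) ^ ε) :
    Summit.ABC.ABC.Theses.DefiniteXi.SteinbergCore := by
  intro ε hε
  obtain ⟨C₀, hC₀⟩ := hC (ε / 4) (by linarith)
  obtain ⟨C₁, hC₁⟩ := hP (ε / 4) (by linarith)
  obtain ⟨C₂, hC₂⟩ := hT (ε / 8) (by linarith)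
  refine ⟨max C₀ 0 * max C₁ 0 * max C₂ 0 ^ 4, ?_⟩
  intro a b hab h0 N _ hN Nm hodd hsq hcard hdvd
  have hNpos : (0 : ℝ) < (N : ℝ) := by exact_mod_cast Nat.pos_of_ne_zero (NeZero.ne N)
  set ξ : ℕ := brandtXi (N / Nm) Nm (fun n => (freyCurve a b).LFunction n) with hξ
  set T : ℕ := ∏ q ∈ N.primeFactors, ((freyCurve a b).minimalDiscriminantNorm ℤ).factorization q with hTdef
  -- exponent bookkeeping: `N^(ε/4) · N^(2 + ε/4) · (N^(ε/8))⁴ = N^(2+ε)`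
  have hfour : ((N : ℝ) ^ (ε / 8)) ^ (4 : ℕ) = (N : ℝ) ^ (ε / 2) := by
    rw [← Real.rpow_natCast ((N : ℝ) ^ (ε / 8)) 4, ← Real.rpow_mul hNpos.le]
    congr 1
    push_cast
    ring
  have hsplit : (N : ℝ) ^ (ε / 4) * (N : ℝ) ^ (2 + ε / 4) * ((N : ℝ) ^ (ε / 8)) ^ (4 : ℕ) =
      (N : ℝ) ^ (2 + ε) := by
    rw [hfour, ← Real.rpow_add hNpos, ← Real.rpow_add hNpos]
    ring_nf
  have hRHS0 : (0 : ℝ) ≤ max C₀ 0 * max C₁ 0 * max C₂ 0 ^ 4 * (N : ℝ) ^ (2 + ε) := by positivity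
  have hT0 : (0 : ℝ) ≤ (T : ℝ) := by positivity
  have hTle : (T : ℝ) ≤ max C₂ 0 * (N : ℝ) ^ (ε / 8) := by
    refine (hC₂ a b hab h0 N hN).trans ?_
    exact mul_le_mul_of_nonneg_right (le_max_left _ _) (by positivity)
  by_cases hξ0 : ξ = 0
  · -- junk branch: no eigen-line (`ξ = 0`), the left side vanishes
    have : ξ / (ordProj[2] ξ * ordProj[3] ξ) = 0 := by rw [hξ0, Nat.zero_div]
    rw [this]
    simpa using hRHS0
  · obtain ⟨D, hDmin, hcmp⟩ := hC₀ a b hab h0 N hN Nm hodd hsq hcard hdvd hξ0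
    have hP' : ((D.deg / (ordProj[2] D.deg * ordProj[3] D.deg) : ℕ) : ℝ) ≤
        max C₁ 0 * (N : ℝ) ^ (2 + ε / 4) :=
      (hC₁ a b hab h0 N hN D hDmin).trans
        (mul_le_mul_of_nonneg_right (le_max_left _ _) (by positivity))
    have hcmp' : ((ξ / (ordProj[2] ξ * ordProj[3] ξ) : ℕ) : ℝ) ≤
        max C₀ 0 * (N : ℝ) ^ (ε / 4) * ((D.deg / (ordProj[2] D.deg * ordProj[3] D.deg) : ℕ) : ℝ) *
          (T : ℝ) ^ 3 := by
      refine hcmp.trans ?_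
      have h1 : (0 : ℝ) ≤ (N : ℝ) ^ (ε / 4) * ((D.deg / (ordProj[2] D.deg * ordProj[3] D.deg) : ℕ) : ℝ) *
          (T : ℝ) ^ 3 := by positivity
      calc C₀ * (N : ℝ) ^ (ε / 4) * ((D.deg / (ordProj[2] D.deg * ordProj[3] D.deg) : ℕ) : ℝ) * (T : ℝ) ^ 3
          = C₀ * ((N : ℝ) ^ (ε / 4) * ((D.deg / (ordProj[2] D.deg * ordProj[3] D.deg) : ℕ) : ℝ) *
              (T : ℝ) ^ 3) := by ring
        _ ≤ max C₀ 0 * ((N : ℝ) ^ (ε / 4) * ((D.deg / (ordProj[2] D.deg * ordProj[3] D.deg) : ℕ) : ℝ) *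
              (T : ℝ) ^ 3) := mul_le_mul_of_nonneg_right (le_max_left _ _) h1
        _ = _ := by ring
    calc ((ξ / (ordProj[2] ξ * ordProj[3] ξ) : ℕ) : ℝ) * (T : ℝ)
        ≤ (max C₀ 0 * (N : ℝ) ^ (ε / 4) * ((D.deg / (ordProj[2] D.deg * ordProj[3] D.deg) : ℕ) : ℝ) *
            (T : ℝ) ^ 3) * (T : ℝ) := mul_le_mul_of_nonneg_right hcmp' hT0
      _ = max C₀ 0 * (N : ℝ) ^ (ε / 4) * ((D.deg / (ordProj[2] D.deg * ordProj[3] D.deg) : ℕ) : ℝ) *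
            (T : ℝ) ^ (4 : ℕ) := by ring
      _ ≤ max C₀ 0 * (N : ℝ) ^ (ε / 4) * (max C₁ 0 * (N : ℝ) ^ (2 + ε / 4)) *
            (max C₂ 0 * (N : ℝ) ^ (ε / 8)) ^ (4 : ℕ) := by
          gcongr
      _ = max C₀ 0 * max C₁ 0 * max C₂ 0 ^ 4 *
            ((N : ℝ) ^ (ε / 4) * (N : ℝ) ^ (2 + ε / 4) * ((N : ℝ) ^ (ε / 8)) ^ (4 : ℕ)) := by ring
      _ = max C₀ 0 * max C₁ 0 * max C₂ 0 ^ 4 * (N : ℝ) ^ (2 + ε) := by rw [hsplit]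

/-- **Composition** (4-ary, concludes the crux BY NAME): stub 1a → stub 1b → stub 2 → stub 3 → `SteinbergCore`, through the landed
child-1 theorem (Xi10), the inlined landed glue and the landed `stub_allTamExp_of_valuationProduct`. -/
theorem SteinbergCore_of :
    (∀ (a b : ℤ), IsCoprime a b → a * b * (a + b) ≠ 0 →
      ∀ (N : ℕ) [NeZero N], (Literature.NumberTheory.EllipticCurves.freyCurve a b).conductorNorm ℤ = N →
      ∀ (D : Literature.NumberTheory.EllipticCurves.ModularForms.ModularParametrizationData
          (Literature.NumberTheory.EllipticCurves.freyCurve a b) N) (p : ℕ), p.Prime → 5 ≤ p →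
        padicValNat p (Literature.NumberTheory.EllipticCurves.ModularForms.congruenceNumber D.f) ≤
          padicValNat p D.modularDegree) →
    (∀ a b : ℤ, IsCoprime a b → a * b * (a + b) ≠ 0 → ∀ (N : ℕ) [NeZero N],
      (Literature.NumberTheory.EllipticCurves.freyCurve a b).conductorNorm ℤ = N →
      Nonempty (Literature.NumberTheory.EllipticCurves.ModularForms.ModularParametrizationData
        (Literature.NumberTheory.EllipticCurves.freyCurve a b) N)) →
    (∀ ε : ℝ, 0 < ε → ∃ C : ℝ, ∀ a b : ℤ, IsCoprime a b → a * b * (a + b) ≠ 0 → ∀ (N : ℕ) [NeZero N],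
      (Literature.NumberTheory.EllipticCurves.freyCurve a b).conductorNorm ℤ = N →
      ∀ D : Literature.NumberTheory.EllipticCurves.ModularForms.ModularParametrizationData
        (Literature.NumberTheory.EllipticCurves.freyCurve a b) N,
        (∀ D' : Literature.NumberTheory.EllipticCurves.ModularForms.ModularParametrizationData
          (Literature.NumberTheory.EllipticCurves.freyCurve a b) N, D.deg ≤ D'.deg) →
        ((D.deg / (ordProj[2] D.deg * ordProj[3] D.deg) : ℕ) : ℝ) ≤ C * (N : ℝ) ^ (2 + ε)) →
    (∀ ε : ℝ, 0 < ε → ∃ K : ℝ, ∀ a b c : ℕ, Literature.NumberTheory.DiophantineGeometry.IsABCTriple a b c →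
      ((∏ p ∈ (a * b * c).primeFactors, (a * b * c).factorization p : ℕ) : ℝ) ≤
        K * ((Literature.NumberTheory.DiophantineGeometry.rad a b c : ℕ) : ℝ) ^ ε) →
    Summit.ABC.ABC.Theses.DefiniteXi.SteinbergCore :=
  fun h1a h1b hP hAVP =>
    glueFrey_inline
      (Summit.ABC.ABC.Theorems.SteinbergCoreXi.StubIdeasK1G11.stub_xiDegreeComparison_of_oneSided h1a h1b) hP
      (Summit.ABC.ABC.Theorems.stub_allTamExp_of_valuationProduct hAVP)

/-- The crux from the four stubs. -/
theorem steinbergCore : Summit.ABC.ABC.Theses.DefiniteXi.SteinbergCore :=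
  SteinbergCore_of stub_oneSidedFrey stub_freyModularity stub_primeToSixDegreeBound stub_abcValuationProduct

/-- Interface test: the fact-conditional closes of stubs 1a/1b quoted in their docstrings elaborate. -/
example (hARS : Literature.NumberTheory.EllipticCurves.ModularForms.padicValNat_congruenceNumber_eq_of_not_sq_dvd) :
    ∀ (a b : ℤ), IsCoprime a b → a * b * (a + b) ≠ 0 →
      ∀ (N : ℕ) [NeZero N], (Literature.NumberTheory.EllipticCurves.freyCurve a b).conductorNorm ℤ = N →
      ∀ (D : Literature.NumberTheory.EllipticCurves.ModularForms.ModularParametrizationData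
          (Literature.NumberTheory.EllipticCurves.freyCurve a b) N) (p : ℕ), p.Prime → 5 ≤ p →
        padicValNat p (Literature.NumberTheory.EllipticCurves.ModularForms.congruenceNumber D.f) ≤
          padicValNat p D.modularDegree :=
  fun _ _ hab h0 _ _ hN D _ hp h5 =>
    Summit.ABC.ABC.Theorems.SteinbergCoreXi.StubIdeasK1G11.padicValNat_congruenceNumber_le_padicValNat_deg_of_frey
      hARS hab h0 hN D hp h5

end

end Summit.ABC.ABC.Cruxes.SteinbergCore.P6TamagawaSplitR45
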